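import Mathlib
import Summits.NavierStokesRegularity.NavierStokesRegularity.Theorems.FilamentSkeletonRssKelvinGateFreeResolvent

/-!
# Route `FilamentSkeletonRss` · cruxes `TransverseReductionRJ` (stmt-21221, aside) / `TransverseReduction1A` (stmt-27414) —
# line `kelvin_gate`: SHARP WEIGHTS of the free resolvent — `⟨y⟩^{3/2}|DW|` and `⟨y⟩²|D²W|` are bounded

Helper file (theorems only, `--as helper`).  HONEST FRAMING: analysis bookkeeping for a HYPOTHETICAL filament-type rotating
self-similar blow-up route; nothing here bears on Navier–Stokes regularity; no stub is proved here.

The X-scale of the gate records the weight `⟨y⟩ = 1 + |y|` on `W, DW, D²W` alike (`free_resolvent`: `YBound F R ⇒ XBound W (C R)`).  For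
the free resolvent `W = ∫₀^∞ W_s ds` of a Y-datum the derivatives decay FASTER, because every derivative falling on the datum
(`(1+|z|)²‖DF‖ ≤ A′`) keeps the data weight two and only costs the slice factor `e^{-s/2}`:

* `heatTime_rpow_neg_half_le_one_add` — `(1 − e^{-s})^{-1/2} ≤ 1 + s^{-1/2}` (replaces `≤ s^{-1/2}e^{s/2}`, which loses at large `s`);
* `inv_weight_sq_le_exp` — `(1 + e^{-s/2}a)^{-2} ≤ e^{s}(1+a)^{-2}`; `rpow_three_halves_weight_le` — `(1+a)^{3/2} ≤ e^{3s/4}(1+e^{-s/2}a)²`;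
* `norm_fderiv_freeSlice_le_weight_three_halves` — `(1+|y|)^{3/2}‖DW_s(y)‖ ≤ 2C_G A′ e^{-s/4}`;
* `norm_fderiv_fderiv_freeSlice_le_sq_weight` — `(1+|y|)²‖D²W_s(y)‖ ≤ 5·2^{3/2}C_G A′ (1 + s^{-1/2}) e^{-s/2}`;
* `free_resolvent_sharp` — **∃ absolute `C`, ∀ α F R, `YBound F R` ⇒ `(1+|y|)^{3/2}‖DW(y)‖ ≤ C R` and `(1+|y|)²‖D²W(y)‖ ≤ C R`**.

Why it matters (memo FREE-GATE-PRESSURE-21221-g7 §3, sharpened): with the sharp weights the quadratic forcing `B = DW[W]` has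
`(1+|y|)³‖DB‖ ≲ R²` — one power of `⟨y⟩` to spare over the Y-weight two — so the free pressure gradient of `B`, estimated by kernel SIZE
only (`…KelvinGatePressureGradient`), is `O(⟨y⟩^{-2+δ})`, subcritical: the Calderón–Zygmund step of the pressure route is needed only
at the critical weights of the coarse `XBound`, not for the resolvent's actual output.
-/

set_option linter.dupNamespace false

noncomputable section

namespace Summit.NavierStokesRegularity.NavierStokesRegularity.Theorems.KelvinGate

open Set Function Filter Topology InnerProductSpace MeasureTheory Real Metric
open Literature.Analysis.FluidPDE Literature.Analysis.UnboundedOperators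
open scoped Laplacian RealInnerProductSpace ContDiff Topology ENNReal

/-! ## Two elementary weight inequalities -/

/-- `(1 − e^{-s})^{-1/2} ≤ 1 + s^{-1/2}` for `s > 0` (from `1 − e^{-s} ≥ s/(1+s)` and `(1 + u)^{1/2} ≤ 1 + u^{1/2}`). -/
theorem heatTime_rpow_neg_half_le_one_add {s : ℝ} (hs : 0 < s) :
    (1 - exp (-s)) ^ (-(1 / 2 : ℝ)) ≤ 1 + s ^ (-(1 / 2 : ℝ)) := by
  have h1 : s / (1 + s) ≤ 1 - exp (-s) := by
    have h := add_one_le_exp s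
    have he : 0 < exp (-s) := exp_pos _
    have h2 : (s + 1) * exp (-s) ≤ 1 := by
      have := mul_le_mul_of_nonneg_right h he.le
      rwa [← exp_add, add_neg_cancel, exp_zero] at this
    rw [div_le_iff₀ (by linarith)]
    nlinarith
  have hpos : 0 < s / (1 + s) := by positivity
  calc (1 - exp (-s)) ^ (-(1 / 2 : ℝ)) ≤ (s / (1 + s)) ^ (-(1 / 2 : ℝ)) :=
        rpow_le_rpow_of_nonpos hpos h1 (by norm_num)
    _ = (1 + s⁻¹) ^ (1 / 2 : ℝ) := by
        rw [rpow_neg hpos.le, ← inv_rpow hpos.le, inv_div, add_div, div_self hs.ne', one_div, add_comm]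
    _ ≤ (1 : ℝ) ^ (1 / 2 : ℝ) + s⁻¹ ^ (1 / 2 : ℝ) :=
        rpow_add_le_add_rpow zero_le_one (inv_nonneg.2 hs.le) (by norm_num) (by norm_num)
    _ = 1 + s ^ (-(1 / 2 : ℝ)) := by rw [one_rpow, inv_rpow hs.le, ← rpow_neg hs.le]

/-- `(1 + e^{-s/2}a)^{-2} ≤ e^{s} (1 + a)^{-2}` for `s, a ≥ 0` (since `1 + e^{-s/2}a ≥ e^{-s/2}(1+a)`). -/
theorem inv_weight_sq_le_exp {s a : ℝ} (hs : 0 ≤ s) (ha : 0 ≤ a) :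
    ((1 + exp (-(s / 2)) * a) ^ 2)⁻¹ ≤ exp s / (1 + a) ^ 2 := by
  have he : 0 < exp (-(s / 2)) := exp_pos _
  have he1 : exp (-(s / 2)) ≤ 1 := exp_le_one_iff.mpr (by linarith)
  have h1 : exp (-(s / 2)) * (1 + a) ≤ 1 + exp (-(s / 2)) * a := by nlinarith
  have h2 : (exp (-(s / 2)) * (1 + a)) ^ 2 ≤ (1 + exp (-(s / 2)) * a) ^ 2 :=
    pow_le_pow_left₀ (by positivity) h1 2
  have h3 : (exp (-(s / 2)) * (1 + a)) ^ 2 = (exp s)⁻¹ * (1 + a) ^ 2 := by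
    rw [mul_pow, ← Real.exp_nat_mul, ← Real.exp_neg]; congr 2; push_cast; ring
  rw [h3] at h2
  calc ((1 + exp (-(s / 2)) * a) ^ 2)⁻¹ ≤ ((exp s)⁻¹ * (1 + a) ^ 2)⁻¹ := inv_anti₀ (by positivity) h2
    _ = exp s / (1 + a) ^ 2 := by rw [mul_inv, inv_inv, div_eq_mul_inv]

/-- `(1 + a)^{3/2} ≤ e^{3s/4} (1 + e^{-s/2}a)²` for `s, a ≥ 0`. -/
theorem rpow_three_halves_weight_le {s a : ℝ} (hs : 0 ≤ s) (ha : 0 ≤ a) :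
    (1 + a) ^ (3 / 2 : ℝ) ≤ exp (3 * s / 4) * (1 + exp (-(s / 2)) * a) ^ 2 := by
  have he : 0 < exp (-(s / 2)) := exp_pos _
  have he1 : exp (-(s / 2)) ≤ 1 := exp_le_one_iff.mpr (by linarith)
  have hw1 : 1 ≤ 1 + exp (-(s / 2)) * a := by nlinarith
  -- `1 + a ≤ e^{s/2}(1 + e^{-s/2}a)`
  have h1 : 1 + a ≤ exp (s / 2) * (1 + exp (-(s / 2)) * a) := by
    have h3 : exp (s / 2) * exp (-(s / 2)) = 1 := by rw [← exp_add, add_neg_cancel, exp_zero]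
    have h4 : 1 ≤ exp (s / 2) := one_le_exp (by linarith)
    nlinarith
  calc (1 + a) ^ (3 / 2 : ℝ) ≤ (exp (s / 2) * (1 + exp (-(s / 2)) * a)) ^ (3 / 2 : ℝ) :=
        rpow_le_rpow (by positivity : (0:ℝ) ≤ 1 + a) h1 (by norm_num)
    _ = exp (3 * s / 4) * (1 + exp (-(s / 2)) * a) ^ (3 / 2 : ℝ) := by
        rw [mul_rpow (exp_pos _).le (show (0:ℝ) ≤ 1 + exp (-(s / 2)) * a by positivity), ← Real.exp_mul]
        congr 2; ring
    _ ≤ exp (3 * s / 4) * (1 + exp (-(s / 2)) * a) ^ (2 : ℝ) :=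
        mul_le_mul_of_nonneg_left (rpow_le_rpow_of_exponent_le hw1 (by norm_num)) (exp_pos _).le
    _ = exp (3 * s / 4) * (1 + exp (-(s / 2)) * a) ^ 2 := by rw [rpow_two]

section Sharp

variable {F : EuclideanSpace ℝ (Fin 3) → EuclideanSpace ℝ (Fin 3)} {C₀ C₁ : ℝ}

/-! ## Sharp slice bounds -/

/-- **`(1+|y|)^{3/2}‖DW_s(y)‖ ≤ 2 C_G A′ e^{-s/4}`** (the derivative falls on the datum; weight two of `DF` is kept). -/
theorem norm_fderiv_freeSlice_le_weight_three_halves {C_G : ℝ} (hCG : 0 ≤ C_G)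
    (hG : ∀ ⦃t : ℝ⦄, 0 < t → ∀ {f : EuclideanSpace ℝ (Fin 3) → EuclideanSpace ℝ (Fin 3) →L[ℝ] EuclideanSpace ℝ (Fin 3)},
      Continuous f → ∀ {A : ℝ}, (∀ y, (1 + ‖y‖) ^ 2 * ‖f y‖ ≤ A) → ∀ x : EuclideanSpace ℝ (Fin 3),
        (1 + ‖x‖) ^ 2 * ‖heatExtension f t x‖ ≤ C_G * (1 + t ^ (3 / 2 : ℝ)) * A)
    (hF : ContDiff ℝ 1 F) (h0 : ∀ z, ‖F z‖ ≤ C₀) {A' : ℝ} (hA' : ∀ z, (1 + ‖z‖) ^ 2 * ‖fderiv ℝ F z‖ ≤ A')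
    (α : ℝ) {s : ℝ} (hs : 0 < s) (y : EuclideanSpace ℝ (Fin 3)) :
    (1 + ‖y‖) ^ (3 / 2 : ℝ) * ‖fderiv ℝ (fun z => (Real.exp (-(s / 2)) • rotZL (-(α * s)))
        (heatExtension F (1 - Real.exp (-s)) ((Real.exp (-(s / 2)) • rotZL (α * s)) z))) y‖ ≤
      2 * C_G * A' * exp (-(s / 4)) := by
  obtain ⟨hτ, hτ1⟩ := heatTime_mem_Ioc hs
  have hA1 : ∀ z, ‖fderiv ℝ F z‖ ≤ A' := fun z => by
    have h1 : 1 ≤ (1 + ‖z‖) ^ 2 := one_le_pow₀ (by linarith [norm_nonneg z])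
    have := hA' z
    nlinarith [norm_nonneg (fderiv ℝ F z)]
  have hA0 : 0 ≤ A' := (norm_nonneg _).trans (hA1 0)
  set x := (Real.exp (-(s / 2)) • rotZL (α * s)) y with hx
  have hxn : ‖x‖ = exp (-(s / 2)) * ‖y‖ := by
    rw [hx, norm_smul_rotZL_apply, abs_of_pos (exp_pos _)]
  have hfun : fderiv ℝ (heatExtension F (1 - exp (-s))) x = heatExtension (fderiv ℝ F) (1 - exp (-s)) x :=
    fderiv_heatExtension_of_bounded hF h0 hA1 hτ x
  have hcont : Continuous (fderiv ℝ F) := hF.continuous_fderiv one_ne_zero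
  have hg := hG hτ hcont hA' x
  have h32 : (1 - exp (-s)) ^ (3 / 2 : ℝ) ≤ 1 := rpow_le_one hτ.le hτ1 (by norm_num)
  have hgx : (1 + ‖x‖) ^ 2 * ‖heatExtension (fderiv ℝ F) (1 - exp (-s)) x‖ ≤ 2 * C_G * A' := by
    refine hg.trans ?_
    have : C_G * (1 + (1 - exp (-s)) ^ (3 / 2 : ℝ)) ≤ 2 * C_G := by nlinarith
    nlinarith
  have hder := norm_fderiv_freeSlice_le hF.continuous h0 α hs y
  rw [hfun] at hder
  have hw : (1 + ‖y‖) ^ (3 / 2 : ℝ) ≤ exp (3 * s / 4) * (1 + ‖x‖) ^ 2 := by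
    rw [hxn]; exact rpow_three_halves_weight_le hs.le (norm_nonneg y)
  calc (1 + ‖y‖) ^ (3 / 2 : ℝ) * ‖fderiv ℝ (fun z => (Real.exp (-(s / 2)) • rotZL (-(α * s)))
          (heatExtension F (1 - Real.exp (-s)) ((Real.exp (-(s / 2)) • rotZL (α * s)) z))) y‖
      ≤ (exp (3 * s / 4) * (1 + ‖x‖) ^ 2) * (exp (-s) * ‖heatExtension (fderiv ℝ F) (1 - exp (-s)) x‖) :=
        mul_le_mul hw hder (norm_nonneg _) (by positivity)
    _ = exp (3 * s / 4) * exp (-s) * ((1 + ‖x‖) ^ 2 * ‖heatExtension (fderiv ℝ F) (1 - exp (-s)) x‖) := by ring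
    _ ≤ exp (3 * s / 4) * exp (-s) * (2 * C_G * A') := mul_le_mul_of_nonneg_left hgx (by positivity)
    _ = 2 * C_G * A' * exp (-(s / 4)) := by
        rw [← exp_add, show 3 * s / 4 + -s = -(s / 4) by ring]; ring

/-- **`(1+|y|)²‖D²W_s(y)‖ ≤ 5·2^{3/2} C_G A′ (1 + s^{-1/2}) e^{-s/2}`** (one derivative on the datum, one on the kernel; weight two
kept: `e^{-3s/2}·e^{s} = e^{-s/2}`). -/
theorem norm_fderiv_fderiv_freeSlice_le_sq_weight {C_G : ℝ} (hCG : 0 ≤ C_G)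
    (hG' : ∀ ⦃t : ℝ⦄, 0 < t → ∀ {f : EuclideanSpace ℝ (Fin 3) → EuclideanSpace ℝ (Fin 3) →L[ℝ] EuclideanSpace ℝ (Fin 3)},
      Continuous f → ∀ {A : ℝ}, (∀ y, (1 + ‖y‖) ^ 2 * ‖f y‖ ≤ A) → ∀ x : EuclideanSpace ℝ (Fin 3),
        (1 + ‖x‖) ^ 2 * ‖fderiv ℝ (heatExtension f t) x‖ ≤
          (2 : ℝ) ^ ((3 : ℝ) / 2) * t ^ (-(1 / 2 : ℝ)) * (C_G * (1 + (2 * t) ^ (3 / 2 : ℝ)) * A))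
    (hF : ContDiff ℝ 1 F) (h0 : ∀ z, ‖F z‖ ≤ C₀) {A' : ℝ} (hA' : ∀ z, (1 + ‖z‖) ^ 2 * ‖fderiv ℝ F z‖ ≤ A')
    (α : ℝ) {s : ℝ} (hs : 0 < s) (y : EuclideanSpace ℝ (Fin 3)) :
    (1 + ‖y‖) ^ 2 * ‖fderiv ℝ (fun z => fderiv ℝ (fun z => (Real.exp (-(s / 2)) • rotZL (-(α * s)))
        (heatExtension F (1 - Real.exp (-s)) ((Real.exp (-(s / 2)) • rotZL (α * s)) z))) z) y‖ ≤
      5 * (2 : ℝ) ^ ((3 : ℝ) / 2) * C_G * A' * ((1 + s ^ (-(1 / 2 : ℝ))) * exp (-(s / 2))) := by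
  obtain ⟨hτ, hτ1⟩ := heatTime_mem_Ioc hs
  have hA1 : ∀ z, ‖fderiv ℝ F z‖ ≤ A' := fun z => by
    have h1 : 1 ≤ (1 + ‖z‖) ^ 2 := one_le_pow₀ (by linarith [norm_nonneg z])
    have := hA' z
    nlinarith [norm_nonneg (fderiv ℝ F z)]
  have hA0 : 0 ≤ A' := (norm_nonneg _).trans (hA1 0)
  set x := (Real.exp (-(s / 2)) • rotZL (α * s)) y with hx
  have hxn : ‖x‖ = exp (-(s / 2)) * ‖y‖ := by
    rw [hx, norm_smul_rotZL_apply, abs_of_pos (exp_pos _)]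
  have hfun : fderiv ℝ (heatExtension F (1 - exp (-s))) = heatExtension (fderiv ℝ F) (1 - exp (-s)) :=
    funext fun z => fderiv_heatExtension_of_bounded hF h0 hA1 hτ z
  have hcont : Continuous (fderiv ℝ F) := hF.continuous_fderiv one_ne_zero
  have hg := hG' hτ hcont hA' x
  have h4 : (2 * (1 - exp (-s))) ^ (3 / 2 : ℝ) ≤ 4 := two_mul_rpow_three_halves_le hτ.le hτ1
  set K : ℝ := 5 * (2 : ℝ) ^ ((3 : ℝ) / 2) * C_G * A' with hK
  have hK0 : 0 ≤ K := by positivity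
  have hgx : (1 + ‖x‖) ^ 2 * ‖fderiv ℝ (heatExtension (fderiv ℝ F) (1 - exp (-s))) x‖ ≤
      K * (1 - exp (-s)) ^ (-(1 / 2 : ℝ)) := by
    refine hg.trans ?_
    have h5 : C_G * (1 + (2 * (1 - exp (-s))) ^ (3 / 2 : ℝ)) * A' ≤ 5 * C_G * A' := by
      have : C_G * (1 + (2 * (1 - exp (-s))) ^ (3 / 2 : ℝ)) ≤ 5 * C_G := by nlinarith
      nlinarith
    have hr : 0 ≤ (2 : ℝ) ^ ((3 : ℝ) / 2) * (1 - exp (-s)) ^ (-(1 / 2 : ℝ)) := by positivity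
    calc (2 : ℝ) ^ ((3 : ℝ) / 2) * (1 - exp (-s)) ^ (-(1 / 2 : ℝ)) * (C_G * (1 + (2 * (1 - exp (-s))) ^ (3 / 2 : ℝ)) * A')
        ≤ (2 : ℝ) ^ ((3 : ℝ) / 2) * (1 - exp (-s)) ^ (-(1 / 2 : ℝ)) * (5 * C_G * A') :=
          mul_le_mul_of_nonneg_left h5 hr
      _ = K * (1 - exp (-s)) ^ (-(1 / 2 : ℝ)) := by rw [hK]; ring
  have hder := norm_fderiv_fderiv_freeSlice_le hF.continuous h0 α hs y
  rw [hfun] at hder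
  -- weights: `(1+|y|)² ≤ e^{s}(1+|x|)²`
  have hw : (1 + ‖y‖) ^ 2 ≤ exp s * (1 + ‖x‖) ^ 2 := by
    have h := inv_weight_sq_le_exp hs.le (norm_nonneg y)
    rw [hxn]
    have hpos : 0 < (1 + exp (-(s / 2)) * ‖y‖) ^ 2 := by positivity
    have hpos' : 0 < (1 + ‖y‖) ^ 2 := by positivity
    rw [inv_le_iff_one_le_mul₀ hpos, div_mul_eq_mul_div, one_le_div hpos'] at h
    exact h
  have h3 := heatTime_rpow_neg_half_le_one_add hs
  calc (1 + ‖y‖) ^ 2 * ‖fderiv ℝ (fun z => fderiv ℝ (fun z => (Real.exp (-(s / 2)) • rotZL (-(α * s)))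
          (heatExtension F (1 - Real.exp (-s)) ((Real.exp (-(s / 2)) • rotZL (α * s)) z))) z) y‖
      ≤ (exp s * (1 + ‖x‖) ^ 2) *
          (exp (-(s / 2)) * exp (-s) * ‖fderiv ℝ (heatExtension (fderiv ℝ F) (1 - exp (-s))) x‖) :=
        mul_le_mul hw hder (by positivity) (by positivity)
    _ = exp s * exp (-(s / 2)) * exp (-s) * ((1 + ‖x‖) ^ 2 * ‖fderiv ℝ (heatExtension (fderiv ℝ F) (1 - exp (-s))) x‖) := by
        ring
    _ ≤ exp s * exp (-(s / 2)) * exp (-s) * (K * (1 - exp (-s)) ^ (-(1 / 2 : ℝ))) :=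
        mul_le_mul_of_nonneg_left hgx (by positivity)
    _ ≤ exp s * exp (-(s / 2)) * exp (-s) * (K * (1 + s ^ (-(1 / 2 : ℝ)))) := by gcongr
    _ = K * ((1 + s ^ (-(1 / 2 : ℝ))) * (exp s * exp (-(s / 2)) * exp (-s))) := by ring
    _ = K * ((1 + s ^ (-(1 / 2 : ℝ))) * exp (-(s / 2))) := by
        rw [← exp_add, ← exp_add]; congr 3; ring

/-! ## The sharp weighted bounds of the resolvent -/

/-- The kernel `(1 + s^{-1/2}) e^{-s/2}` is integrable on `(0, ∞)`. -/
theorem integrableOn_one_add_rpow_neg_half_mul_exp :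
    IntegrableOn (fun s : ℝ => (1 + s ^ (-(1 / 2 : ℝ))) * exp (-(s / 2))) (Ioi 0) := by
  have h1 := integral_exp_neg_half_Ioi.1
  have h2 : IntegrableOn (fun s : ℝ => s ^ (-(1 / 2 : ℝ)) * exp (-(s / 2))) (Ioi 0) := by
    have h : IntegrableOn (fun s : ℝ => s ^ (-(1 / 2 : ℝ)) * exp (-((1 / 2 : ℝ) * s))) (Ioi 0) :=
      integrableOn_rpow_neg_half_mul_exp_neg (by norm_num)
    exact h.congr_fun (fun s _ => by beta_reduce; rw [show -((1 / 2 : ℝ) * s) = -(s / 2) by ring]) measurableSet_Ioi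
  exact (h1.add h2).congr_fun (fun s _ => by simp only [Pi.add_apply]; ring) measurableSet_Ioi

/-- **SHARP WEIGHTS OF THE FREE RESOLVENT.**  There is an absolute `C ≥ 0` such that for every rate `α` and every Y-datum
(`YBound F R`) the free resolvent `W = ∫₀^∞ W_s ds` satisfies `(1+|y|)^{3/2}‖DW(y)‖ ≤ C R` and `(1+|y|)²‖D²W(y)‖ ≤ C R` for all `y`
(compare `XBound W (C R)`: weight one on both). -/
theorem free_resolvent_sharp :
    ∃ C : ℝ, 0 ≤ C ∧ ∀ (α : ℝ) (F : EuclideanSpace ℝ (Fin 3) → EuclideanSpace ℝ (Fin 3)) (R : ℝ), YBound F R →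
      ∀ y : EuclideanSpace ℝ (Fin 3),
        (1 + ‖y‖) ^ (3 / 2 : ℝ) * ‖fderiv ℝ (fun y => ∫ s in Ioi (0:ℝ), (Real.exp (-(s / 2)) • rotZL (-(α * s)))
            (heatExtension F (1 - Real.exp (-s)) ((Real.exp (-(s / 2)) • rotZL (α * s)) y))) y‖ ≤ C * R ∧
        (1 + ‖y‖) ^ 2 * ‖fderiv ℝ (fderiv ℝ (fun y => ∫ s in Ioi (0:ℝ), (Real.exp (-(s / 2)) • rotZL (-(α * s)))
            (heatExtension F (1 - Real.exp (-s)) ((Real.exp (-(s / 2)) • rotZL (α * s)) y)))) y‖ ≤ C * R := by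
  obtain ⟨C_G, hCG, hG, hG'⟩ := sq_weight_fderiv_heatExtension_le
  set J : ℝ := ∫ s in Ioi (0:ℝ), (1 + s ^ (-(1 / 2 : ℝ))) * exp (-(s / 2)) with hJ
  have hJ0 : 0 ≤ J := setIntegral_nonneg measurableSet_Ioi fun s hs => by
    have : 0 < s := hs
    positivity
  set K₁ : ℝ := 8 * C_G with hK₁
  set K₂ : ℝ := 5 * (2 : ℝ) ^ ((3 : ℝ) / 2) * C_G * J with hK₂
  refine ⟨K₁ + K₂, by positivity, fun α F R hY y => ?_⟩
  obtain ⟨hF, h0, h1, hA, hA'⟩ := hY.unpack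
  have hR : 0 ≤ R := hY.nonneg
  have hFc := hF.continuous
  have hK₁R : K₁ * R ≤ (K₁ + K₂) * R := by nlinarith [mul_nonneg (by positivity : (0:ℝ) ≤ K₂) hR]
  have hK₂R : K₂ * R ≤ (K₁ + K₂) * R := by nlinarith [mul_nonneg (by positivity : (0:ℝ) ≤ K₁) hR]
  -- derivatives under the integral
  have hD1 : fderiv ℝ (fun y => ∫ s in Ioi (0:ℝ), (Real.exp (-(s / 2)) • rotZL (-(α * s)))
        (heatExtension F (1 - Real.exp (-s)) ((Real.exp (-(s / 2)) • rotZL (α * s)) y))) =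
      fun y => ∫ s in Ioi (0:ℝ), fderiv ℝ (fun z => (Real.exp (-(s / 2)) • rotZL (-(α * s)))
        (heatExtension F (1 - Real.exp (-s)) ((Real.exp (-(s / 2)) • rotZL (α * s)) z))) y :=
    funext fun y => (hasFDerivAt_freeResolvent hF h0 h1 α y).fderiv
  have hD2 : fderiv ℝ (fderiv ℝ (fun y => ∫ s in Ioi (0:ℝ), (Real.exp (-(s / 2)) • rotZL (-(α * s)))
        (heatExtension F (1 - Real.exp (-s)) ((Real.exp (-(s / 2)) • rotZL (α * s)) y)))) y =
      ∫ s in Ioi (0:ℝ), fderiv ℝ (fun z => fderiv ℝ (fun z => (Real.exp (-(s / 2)) • rotZL (-(α * s)))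
        (heatExtension F (1 - Real.exp (-s)) ((Real.exp (-(s / 2)) • rotZL (α * s)) z))) z) y := by
    rw [hD1]; exact (hasFDerivAt_fderiv_freeResolvent hF h0 h1 α y).fderiv
  have hy1 : 0 < (1 + ‖y‖) ^ (3 / 2 : ℝ) := by positivity
  have hy2 : 0 < (1 + ‖y‖) ^ 2 := by positivity
  refine ⟨?_, ?_⟩
  · -- first derivative, weight 3/2
    rw [hD1]
    have hI : IntegrableOn (fun s : ℝ => exp (-(s / 4))) (Ioi 0) := by
      have : (fun s : ℝ => exp (-(s / 4))) = fun s => exp ((-(1/4:ℝ)) * s) := by funext s; congr 1; ring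
      rw [this]; exact integrableOn_exp_mul_Ioi (by norm_num) 0
    have hIval : ∫ s in Ioi (0:ℝ), exp (-(s / 4)) = 4 := by
      have : (fun s : ℝ => exp (-(s / 4))) = fun s => exp ((-(1/4:ℝ)) * s) := by funext s; congr 1; ring
      rw [this, integral_exp_mul_Ioi (by norm_num) 0]; norm_num
    have hb : ‖∫ s in Ioi (0:ℝ), fderiv ℝ (fun z => (Real.exp (-(s / 2)) • rotZL (-(α * s)))
          (heatExtension F (1 - Real.exp (-s)) ((Real.exp (-(s / 2)) • rotZL (α * s)) z))) y‖ ≤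
        ∫ s in Ioi (0:ℝ), (2 * C_G * R / (1 + ‖y‖) ^ (3 / 2 : ℝ)) * exp (-(s / 4)) := by
      refine norm_integral_le_of_norm_le (hI.const_mul _) ?_
      refine (ae_restrict_iff' measurableSet_Ioi).2 (Eventually.of_forall fun s hs => ?_)
      have h := norm_fderiv_freeSlice_le_weight_three_halves hCG.le (fun t ht f hf A hfA x => hG ht hf hfA x)
        hF h0 hA' α hs y
      rw [div_mul_eq_mul_div, le_div_iff₀ hy1, mul_comm]
      exact h
    rw [integral_const_mul, hIval] at hb
    calc (1 + ‖y‖) ^ (3 / 2 : ℝ) * ‖∫ s in Ioi (0:ℝ), fderiv ℝ (fun z => (Real.exp (-(s / 2)) • rotZL (-(α * s)))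
            (heatExtension F (1 - Real.exp (-s)) ((Real.exp (-(s / 2)) • rotZL (α * s)) z))) y‖
        ≤ (1 + ‖y‖) ^ (3 / 2 : ℝ) * (2 * C_G * R / (1 + ‖y‖) ^ (3 / 2 : ℝ) * 4) :=
          mul_le_mul_of_nonneg_left hb hy1.le
      _ = K₁ * R := by rw [hK₁]; field_simp; ring
      _ ≤ (K₁ + K₂) * R := hK₁R
  · -- second derivative, weight 2
    rw [hD2]
    have hI := integrableOn_one_add_rpow_neg_half_mul_exp
    have hb : ‖∫ s in Ioi (0:ℝ), fderiv ℝ (fun z => fderiv ℝ (fun z => (Real.exp (-(s / 2)) • rotZL (-(α * s)))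
          (heatExtension F (1 - Real.exp (-s)) ((Real.exp (-(s / 2)) • rotZL (α * s)) z))) z) y‖ ≤
        ∫ s in Ioi (0:ℝ), (5 * (2 : ℝ) ^ ((3 : ℝ) / 2) * C_G * R / (1 + ‖y‖) ^ 2) *
          ((1 + s ^ (-(1 / 2 : ℝ))) * exp (-(s / 2))) := by
      refine norm_integral_le_of_norm_le (hI.const_mul _) ?_
      refine (ae_restrict_iff' measurableSet_Ioi).2 (Eventually.of_forall fun s hs => ?_)
      have h := norm_fderiv_fderiv_freeSlice_le_sq_weight hCG.le (fun t ht f hf A hfA x => hG' ht hf hfA x)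
        hF h0 hA' α hs y
      rw [div_mul_eq_mul_div, le_div_iff₀ hy2, mul_comm]
      exact h
    rw [integral_const_mul] at hb
    calc (1 + ‖y‖) ^ 2 * ‖∫ s in Ioi (0:ℝ), fderiv ℝ (fun z => fderiv ℝ (fun z => (Real.exp (-(s / 2)) • rotZL (-(α * s)))
            (heatExtension F (1 - Real.exp (-s)) ((Real.exp (-(s / 2)) • rotZL (α * s)) z))) z) y‖
        ≤ (1 + ‖y‖) ^ 2 * (5 * (2 : ℝ) ^ ((3 : ℝ) / 2) * C_G * R / (1 + ‖y‖) ^ 2 * J) :=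
          mul_le_mul_of_nonneg_left hb hy2.le
      _ = K₂ * R := by rw [hK₂]; field_simp
      _ ≤ (K₁ + K₂) * R := hK₂R

end Sharp

end Summit.NavierStokesRegularity.NavierStokesRegularity.Theorems.KelvinGate

end
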